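import Mathlib
import Summits.KontsevichZagierPeriods.Zeta5Search.CasoratianClassBoundProof
import Summits.KontsevichZagierPeriods.Zeta5Search.CollinearityShift
import Summits.KontsevichZagierPeriods.Zeta5Search.CellKitLevel
import HarnessLib

/-!
# ζ(5) search — THEOREM LB♯: the Casoratian class bound with the PALINDROMIC `𝒦`-ROW BONUS (DENOM-LAW D1, prover-d1 gen 19)

HONEST FRAMING: systematic search; no irrationality claim unless certified.  Cell `pub-zeta5`, track «DENOM-LAW» D1, seat
`denom-prover-d1` gen 19 (`HOME/denom-law/prover-d1/ATTEMPT-19.md` §5).  `p`-adic valuation bookkeeping of the explicit rationals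
`Cas_j(b)`; nothing about ζ(5); no γ; records in print UNMOVED.

THEOREM LB (`casoratianClassBound_holds`, gen-2 g8 / typer): `v_p(Cas_j(b)) ≥ VB + min{1 [single-pole classes], 3 + E_x [multipole x],
0 [p > d]}`, proved row by row from `‖𝒦_x‖ ≤ p^{−(3+E_x)}`.  For a multipole class whose configuration is a PALINDROME with `3 + E_x` odd
(the «dropped» deep classes of the census) typer g9's `palindromicClassKBound_holds` gives one more: `‖𝒦_x‖ ≤ p^{−(4+E_x)}` (`ĉ_x = 0` by the
involution, then U-K) — for `b` AND, row by row, for `b + e_j` (an unhit class keeps its configuration, `classConfig_shift_of_classExp_eq`; a hit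
class gains an exponent).  Hence **THEOREM LB♯ (`casoratian_bound_pal`, hypothesis form, no new definition): with `v ≤ ν_y` on every pole class and
`r ≤ 1` on single-pole rows, `r ≤ 3 + E_x` on multipole rows OR `r ≤ 4 + E_x` on palindromic multipole rows with `E_x ≤ −3`, `3 + E_x` odd, and
`r ≤ 0` if `d < p`:  `v + r ≤ v_p(Cas_j(b))`.**  No hypothesis on the single-pole classes (unlike the Lemma-D bonus `lemmaDBonus_holds`, which
needs every single above the deep exponent).  USE: the census's open configuration «deep centre-free palindromic pair at `m = −4` with a
non-tame single BELOW it» (node `= casLB + 1`): exact check (`g19/code/lbsharp.py`) — the bound is `≤ v_p(Cas₇)` on 54,713 / 54,713 instances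
at `p ≤ 7` and 30,000 / 30,000 at `p = 11`, and reaches the node on 451 of the 1,443 instances left open at `p ≤ 7` after THEOREM A‴₄ (268 / 965
in the `p = 11` sample).
-/

noncomputable section

open Finset

namespace Summit.KontsevichZagierPeriods.Zeta5Search.ClusterValuation

open Summit.KontsevichZagierPeriods.Zeta5Search.DualSeries (InBox)
open Summit.KontsevichZagierPeriods.Zeta5Search.WedgeDictionary (coeffV dOf)
open Summit.KontsevichZagierPeriods.Zeta5Search.CasoratianValuation (InPolytope shift casoratian)
open Summit.KontsevichZagierPeriods.Zeta5Search.PadicSeries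
open Summit.KontsevichZagierPeriods.Zeta5Search.BigPrime (shift_zero dOf_shift)
open Summit.KontsevichZagierPeriods.Zeta5Search.CellKit (unhit_of_classExp_eq netExp_shift_of_unhit)

variable {p : ℕ} [hp : Fact p.Prime]

omit hp in
/-- An unhit class of `b + e_j` (same class exponent) has the same configuration. -/
theorem classConfig_shift_of_classExp_eq (b : ℕ → ℤ) {j : ℕ} (hb : InPolytope b) (hb' : InPolytope (shift b j))
    (hj1 : 1 ≤ j) (hj7 : j ≤ 7) {x : ℕ} (heq : classExp (shift b j) p x = classExp b p x) :
    classConfig (shift b j) p x = classConfig b p x := by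
  obtain ⟨h1, h2⟩ := unhit_of_classExp_eq b hb hj1 hj7 hb' heq
  have hne : ∀ s ∈ classSet b p x, netExp (shift b j) s = netExp b s := fun s hs => netExp_shift_of_unhit b hb hj1 hj7 hb' h1 h2 hs
  unfold classConfig
  rw [classSet_shift b hj1, shift_zero b hj1]
  have hcen : CentreIn (shift b j) p x ↔ CentreIn b p x := centreIn_shift b hj1 p x
  congr 1
  · rw [filter_congr (fun s hs => by rw [hne s hs])]
    exact image_congr fun s hs => by
      have hs' := (mem_filter.1 (mem_coe.1 hs)).1
      simp only [hne s hs']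
  · by_cases hc : ¬ (2 : ℤ) ∣ b 0 ∧ CentreIn b p x
    · rw [if_pos hc, if_pos ⟨hc.1, hcen.2 hc.2⟩]
    · rw [if_neg hc, if_neg (fun h => hc ⟨h.1, hcen.1 h.2⟩)]

/-- `‖𝒦_x‖ ≤ p^{−(4+E_x)}` for a palindromic multipole class with `E_x ≤ −3` and `3 + E_x` odd (typer g9's
`palindromicClassKBound_holds`, via `MixedPairs.palUnit = 1`). -/
theorem padicNorm_classK_le_pal_four (b : ℕ → ℤ) (hb : InPolytope b) (hp5 : 5 ≤ p) (hpb : (p : ℤ) ≤ b 0)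
    (hwin : (b 0 + 2 : ℤ) < (p : ℤ) ^ 2) {x : ℕ} (hx : x < p) (h2 : 2 ≤ classPoleCount b p x) (hE3 : classExp b p x ≤ -3)
    (hpal : IsPalindromic (classConfig b p x)) (hodd : Odd (3 + classExp b p x)) :
    padicNorm p (classK b p x) ≤ (p : ℚ) ^ (-(4 + classExp b p x)) := by
  have h := padicNorm_classK_le_pal b hb hp5 hpb hwin hx h2
  have heven : Even (classExp b p x) := by
    obtain ⟨k, hk⟩ := hodd; exact ⟨k - 1, by omega⟩
  have hE4 : classExp b p x ≤ -4 := by obtain ⟨k, hk⟩ := heven; omega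
  have hu : palUnit b p x = 1 := by unfold palUnit; rw [if_pos ⟨hpal, heven, hE4⟩]
  rw [hu, show -(3 + classExp b p x + 1) = -(4 + classExp b p x) by ring] at h
  exact h

/-- **THEOREM LB♯ — the Casoratian class bound with the palindromic `𝒦`-row bonus** (hypothesis form).  Window prime `5 ≤ p ≤ b₀ < p² − 2`,
`b` and `b + e_j` in the polytope; `v ≤ ν_y` for every pole class `y`; `r ≤ 1` whenever some class has exactly one pole; for every multipole class
`x` either `r ≤ 3 + E_x`, or `x` is palindromic with `E_x ≤ −3`, `3 + E_x` odd and `r ≤ 4 + E_x`; and `r ≤ 0` if `d < p`.  Then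
`v + r ≤ v_p(Cas_j(b))`. -/
theorem casoratian_bound_pal (b : ℕ → ℤ) (j p : ℕ) (hb : InPolytope b) (hj1 : 1 ≤ j) (hj7 : j ≤ 7) (hb' : InPolytope (shift b j))
    (hprime : p.Prime) (hp5 : 5 ≤ p) (hpb : (p : ℤ) ≤ b 0) (hwin : (b 0 + 2 : ℤ) < (p : ℤ) ^ 2) (v r : ℤ)
    (hv : ∀ x, x < p → 1 ≤ classPoleCount b p x → v ≤ classNu b p x)
    (hr1 : ∀ x, x < p → classPoleCount b p x = 1 → r ≤ 1)
    (hrm : ∀ x, x < p → 2 ≤ classPoleCount b p x →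
      r ≤ 3 + classExp b p x ∨
        (classExp b p x ≤ -3 ∧ IsPalindromic (classConfig b p x) ∧ Odd (3 + classExp b p x) ∧ r ≤ 4 + classExp b p x))
    (hr0 : dOf b < (p : ℤ) → r ≤ 0)
    (hcas : casoratian b j ≠ 0) : v + r ≤ padicValRat p (casoratian b j) := by
  haveI : Fact p.Prime := ⟨hprime⟩
  have hp1 : (1 : ℚ) ≤ p := one_le_p
  have h0' : shift b j 0 = b 0 := shift_zero b hj1
  have hwin' : (shift b j 0 + 2 : ℤ) < (p : ℤ) ^ 2 := by rw [h0']; exact hwin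
  have hpb' : (p : ℤ) ≤ shift b j 0 := by rw [h0']; exact hpb
  have hbox : InBox b := hb.1
  have hcnt : ∀ x, classPoleCount (shift b j) p x ≤ classPoleCount b p x :=
    fun x => classPoleCount_shift_le b hbox hj1 p x
  -- the constant terms
  have hVb : padicNorm p (coeffV b) ≤ (p : ℚ) ^ (-v) := padicNorm_coeffV_le b hb hp5 hwin v hv
  have hVb' : padicNorm p (coeffV (shift b j)) ≤ (p : ℚ) ^ (-v) :=
    padicNorm_coeffV_le (shift b j) hb' hp5 hwin' v fun x hx hpole' =>
      (hv x hx (le_trans hpole' (hcnt x))).trans (classNu_shift_ge b hbox hj1 hpole')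
  -- the rows
  have hrow : ∀ x ∈ range p,
      padicNorm p (classK (shift b j) p x * coeffV b - classK b p x * coeffV (shift b j)) ≤ (p : ℚ) ^ (-(v + r)) := by
    intro x hx
    have hx' := mem_range.1 hx
    rcases Nat.lt_trichotomy (classPoleCount b p x) 1 with hc | hc | hc
    · have h0 : classPoleCount b p x = 0 := by omega
      have h0s : classPoleCount (shift b j) p x = 0 := by have := hcnt x; omega
      rw [classK_eq_zero_of_noPole b hb h0, classK_eq_zero_of_noPole _ hb' h0s, zero_mul, zero_mul, sub_zero,
        padicNorm.zero]
      exact zpow_p_nonneg _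
    · have hr1' : r ≤ 1 := hr1 x hx' hc
      have hK : padicNorm p (classK b p x) ≤ (p : ℚ) ^ (-(1 : ℤ)) := padicNorm_classK_le_single b hb hp5 hwin hx' hc
      have hK' : padicNorm p (classK (shift b j) p x) ≤ (p : ℚ) ^ (-(1 : ℤ)) := by
        rcases Nat.eq_zero_or_pos (classPoleCount (shift b j) p x) with h0s | hpos
        · rw [classK_eq_zero_of_noPole _ hb' h0s, padicNorm.zero]; exact zpow_p_nonneg _
        · exact padicNorm_classK_le_single _ hb' hp5 hwin' hx' (by have := hcnt x; omega)
      refine (padicNorm.sub (p := p)).trans (max_le ?_ ?_)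
      · exact (padicNorm_mul_le hK' hVb).trans (zpow_le_zpow_right₀ hp1 (by linarith))
      · exact (padicNorm_mul_le hK hVb').trans (zpow_le_zpow_right₀ hp1 (by linarith))
    · -- a multipole class of `b`: the row exponent `e` with `r ≤ e` and `‖𝒦_x‖, ‖𝒦⁺_x‖ ≤ p^{-e}`
      have h2 : 2 ≤ classPoleCount b p x := by omega
      obtain ⟨e, hre, hK, hK'⟩ : ∃ e : ℤ, r ≤ e ∧ padicNorm p (classK b p x) ≤ (p : ℚ) ^ (-e) ∧
          padicNorm p (classK (shift b j) p x) ≤ (p : ℚ) ^ (-e) := by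
        have hKs : padicNorm p (classK (shift b j) p x) ≤ (p : ℚ) ^ (-(3 + classExp (shift b j) p x)) := by
          rcases Nat.eq_zero_or_pos (classPoleCount (shift b j) p x) with h0s | hpos
          · rw [classK_eq_zero_of_noPole _ hb' h0s, padicNorm.zero]; exact zpow_p_nonneg _
          · exact padicNorm_classK_le_multi _ hb' hp5 hwin' hx' hpos
        have hge := classExp_shift_ge b hbox hj1 p x
        rcases hrm x hx' h2 with hr3 | ⟨hE3, hpal, hodd, hr4⟩
        · exact ⟨3 + classExp b p x, hr3, padicNorm_classK_le_multi b hb hp5 hwin hx' (by omega),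
            hKs.trans (zpow_le_zpow_right₀ hp1 (by linarith))⟩
        · refine ⟨4 + classExp b p x, hr4, padicNorm_classK_le_pal_four b hb hp5 hpb hwin hx' h2 hE3 hpal hodd, ?_⟩
          by_cases heq : classExp (shift b j) p x = classExp b p x
          · -- unhit: the class of `b + e_j` is the same palindromic multipole class
            have h2s : 2 ≤ classPoleCount (shift b j) p x := by
              rw [classPoleCount_shift_of_classExp_eq b hbox hj1 heq]; exact h2
            have h := padicNorm_classK_le_pal_four (shift b j) hb' hp5 hpb' hwin' hx' h2s (by omega)
              (by rw [classConfig_shift_of_classExp_eq b hb hb' hj1 hj7 heq]; exact hpal) (by rw [heq]; exact hodd)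
            rw [heq] at h
            exact h
          · -- hit: the exponent went up
            by_cases h1s : classPoleCount (shift b j) p x = 1
            · exact (padicNorm_classK_le_single _ hb' hp5 hwin' hx' h1s).trans (zpow_le_zpow_right₀ hp1 (by omega))
            · exact hKs.trans (zpow_le_zpow_right₀ hp1 (by omega))
      refine (padicNorm.sub (p := p)).trans (max_le ?_ ?_)
      · exact (padicNorm_mul_le hK' hVb).trans (zpow_le_zpow_right₀ hp1 (by linarith))
      · exact (padicNorm_mul_le hK hVb').trans (zpow_le_zpow_right₀ hp1 (by linarith))
  have hB : padicNorm p (kRes (shift b j) p * coeffV b - kRes b p * coeffV (shift b j)) ≤ (p : ℚ) ^ (-(v + r)) := by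
    rw [kRes_eq_sum_classK (shift b j) hprime.pos, kRes_eq_sum_classK b hprime.pos, sum_mul, sum_mul,
      ← sum_sub_distrib]
    exact padicNorm.sum_le' hrow (zpow_p_nonneg _)
  -- the Ω-bracket and the assembly (verbatim from THEOREM LB)
  apply val_ge_of_padicNorm_le hcas
  rw [casoratian_split b j p]
  have hdshift : dOf (shift b j) = dOf b - 1 := dOf_shift b hj1 hj7
  by_cases hpd : (p : ℤ) ≤ dOf b
  · rw [omegaRes_eq_zero b hb (by omega), omegaRes_eq_zero (shift b j) hb' (by rw [hdshift]; omega), zero_mul,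
      zero_mul, sub_zero, zero_sub, padicNorm.neg]
    exact hB
  · have hr0' : r ≤ 0 := hr0 (by push Not at hpd; exact hpd)
    refine (padicNorm.sub (p := p)).trans (max_le ?_ hB)
    refine (padicNorm.sub (p := p)).trans (max_le ?_ ?_)
    · have h1 : padicNorm p (omegaRes (shift b j) p) ≤ (p : ℚ) ^ (0 : ℤ) := by
        simpa using padicNorm_omegaRes_le_one (shift b j) hb' (by omega)
      exact (padicNorm_mul_le h1 hVb).trans (zpow_le_zpow_right₀ hp1 (by linarith))
    · have h1 : padicNorm p (omegaRes b p) ≤ (p : ℚ) ^ (0 : ℤ) := by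
        simpa using padicNorm_omegaRes_le_one b hb (by omega)
      exact (padicNorm_mul_le h1 hVb').trans (zpow_le_zpow_right₀ hp1 (by linarith))

end Summit.KontsevichZagierPeriods.Zeta5Search.ClusterValuation

end
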